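import Mathlib
import Summits.KontsevichZagierPeriods.Zeta5Search.Families.SeatingGapGrowth
import HarnessLib

/-!
# ζ(5) search — Families: the gap constant terms of EVERY bijective seating are positive (Hall), hence grow like `1/M_τ`

HONEST FRAMING: systematic search; no irrationality claim unless certified.  Cell `pub-zeta5`, certifier 2 (cert-2 g11,
2026-08-22).  Elementary combinatorics + the real analysis of `Families/SeatingGapGrowth`; nothing about any zeta value; no
conjecture node is used; no number of record moves.

`Families/SeatingGapGrowth.tendsto_log_gapCT_div` has the hypothesis `gapCT τ 1 ≠ 0`.  It always holds: P2's Hall matching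
`Families/BasicMonotone.exists_gap_matching` (an injective choice of a spanned gap for every finite edge of `τδ⁰`, every
bijective seating `τ`) gives the Hall inequalities of `Families/SpanProductHall.one_le_coeff_spanProd_of_hall`, so
* `hall_edgeSpan` — `Σ_{e ∈ S} finExp τ n e ≤ Σ_{w ∈ N(S)} n` for every set `S` of edges;
* **`one_le_gapCT`** — `1 ≤ gapCT τ n` for every `n` (at least one transport table);
* **`tendsto_log_gapCT_div'`** — HYPOTHESIS-FREE: for every bijective seating `τ` of any number `ℓ + 3 ≥ 3` of points,
  `log (gapCT τ n)/n → −log M_τ` — the diagonal gap constant terms of a configuration grow at exactly the exponential rate at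
  which its basic cellular integrals decay (`M_τ = fSup τ`, `Families/BasicGrowth.tendsto_integral_basic_root`).
Standard axioms only.
-/

noncomputable section

open Finset Real Filter Topology

namespace Summit.KontsevichZagierPeriods.Zeta5Search.Families.Cellular

namespace SeatingGap

variable {ℓ : ℕ} (τ : Fin (ℓ + 3) → Fin (ℓ + 3))

/-- **Hall inequalities of the finite edges of `τδ⁰` against the gaps** (weights `n` on finite edges, `0` on the two edges
through `∞`, `n` on every gap). -/
theorem hall_edgeSpan (hτ : Function.Bijective τ) (n : ℕ) (S : Finset (Fin (ℓ + 3))) :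
    ∑ e ∈ S, finExp τ n e ≤ ∑ w ∈ S.biUnion (edgeSpan τ), (fun _ => n) w := by
  classical
  obtain ⟨m, hm, hmem⟩ := exists_gap_matching τ hτ
  -- the finite edges of `S`
  set P : Fin (ℓ + 3) → Prop := fun e => (τ e).val ≠ ℓ + 2 ∧ (τ (e + 1)).val ≠ ℓ + 2 with hP
  have hsumS : ∑ e ∈ S, finExp τ n e = (S.filter P).card * n := by
    rw [Finset.card_eq_sum_ones, Finset.sum_mul, Finset.sum_filter]
    refine Finset.sum_congr rfl fun e _ => ?_
    simp only [finExp]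
    split_ifs <;> simp
  have hsumN : ∑ w ∈ S.biUnion (edgeSpan τ), (fun _ => n) w = (S.biUnion (edgeSpan τ)).card * n := by
    rw [Finset.sum_const, smul_eq_mul]
  rw [hsumS, hsumN]
  refine Nat.mul_le_mul_right n ?_
  -- inject the finite edges of `S` into the covered gaps by the matching
  let f : Fin (ℓ + 3) → Fin (ℓ + 1) := fun e => if h : P e then m ⟨e, h⟩ else 0
  refine Finset.card_le_card_of_injOn f (fun e he => ?_) ?_
  · rw [Finset.mem_coe, Finset.mem_filter] at he
    have hfe : f e = m ⟨e, he.2⟩ := dif_pos he.2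
    rw [Finset.mem_coe, Finset.mem_biUnion]
    refine ⟨e, he.1, ?_⟩
    rw [hfe, edgeSpan_eq_span τ hτ.1 ⟨e, he.2⟩]
    exact hmem _
  · intro e₁ he₁ e₂ he₂ hf
    rw [Finset.mem_coe, Finset.mem_filter] at he₁ he₂
    have h1 : f e₁ = m ⟨e₁, he₁.2⟩ := dif_pos he₁.2
    have h2 : f e₂ = m ⟨e₂, he₂.2⟩ := dif_pos he₂.2
    rw [h1, h2] at hf
    exact congrArg Subtype.val (hm hf)

/-- The total weights agree: `Σ_e finExp τ n e = (ℓ + 1)·n = Σ_w n`. -/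
theorem sum_finExp (hτ : Function.Bijective τ) (n : ℕ) : ∑ e, finExp τ n e = ∑ _w : Fin (ℓ + 1), n := by
  classical
  have h1 : ∑ e, finExp τ n e =
      (univ.filter fun e : Fin (ℓ + 3) => (τ e).val ≠ ℓ + 2 ∧ (τ (e + 1)).val ≠ ℓ + 2).card * n := by
    rw [Finset.card_eq_sum_ones, Finset.sum_mul, Finset.sum_filter]
    refine Finset.sum_congr rfl fun e _ => ?_
    simp only [finExp]
    split_ifs <;> simp
  have h2 : (univ.filter fun e : Fin (ℓ + 3) => (τ e).val ≠ ℓ + 2 ∧ (τ (e + 1)).val ≠ ℓ + 2).card = ℓ + 1 := by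
    rw [← card_sEdge τ hτ, Fintype.card_subtype]
  rw [h1, h2, Finset.sum_const, Finset.card_univ, Fintype.card_fin, smul_eq_mul]

/-- **`gapCT τ n ≥ 1`** for every bijective seating and every `n`: Hall's theorem (`Families/SpanProductHall`). -/
theorem one_le_gapCT (hτ : Function.Bijective τ) (n : ℕ) : 1 ≤ gapCT τ n := by
  classical
  unfold gapCT gapPoly
  rw [smul_ones]
  exact SpanHall.one_le_coeff_spanProd_of_hall (edgeSpan τ) (finExp τ n) (fun _ => n) (hall_edgeSpan τ hτ n)
    (sum_finExp τ hτ n)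

/-- **Growth = reciprocal decay, hypothesis-free**: for every bijective seating `τ`,
`log (gapCT τ n) / n → −log M_τ`. -/
theorem tendsto_log_gapCT_div' (hτ : Function.Bijective τ) :
    Tendsto (fun n : ℕ => Real.log (gapCT τ n : ℝ) / n) atTop (𝓝 (-Real.log (fSup τ))) :=
  tendsto_log_gapCT_div τ hτ (by have := one_le_gapCT τ hτ 1; omega)

end SeatingGap

end Summit.KontsevichZagierPeriods.Zeta5Search.Families.Cellular
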